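import Summits.QuantumFields.GaugeBoot.StrongCouplingOneStep
import HarnessLib

/-!
# The single-link loop equation with an edge-independent MULTIPLIER, and its one-step bound (gauge-boot, Lean layer, ADDENDUM 24 part A)

HONEST FRAMING (cell `pub-gaugeboot`, page 1 of every file): the venture produces certified bounds
on lattice expectations at stated coupling, gauge group, dimension and torus size; NOT a mass gap,
NOT a continuum limit, NOT a string tension; NOT Yang–Mills-summit-bearing (barriers
`FixedCouplingUltralocality`, `PerturbativeInvisibility`).  This file enters no number: it is an exact
Schwinger–Dyson identity and a crude explicit bound, valid on every torus `(ℤ/L)^d` at every real coupling.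

## Content

`LoopEquation.lean` contracts the tree's one-link Schwinger–Dyson identity against `tr(E_ji ρ(hol w))`;
`LoopEquationSpectatorPair.lean` lets the test function carry one spectator LOOP.  For the third loop-equation
step of the strong-coupling expansion (ADDENDUM 24) the test function must carry an arbitrary product of spectator
traces — but only spectators that DO NOT READ the marked link.  For such a multiplier the product rule has no second
term, so the identity is the single-word identity with the multiplier carried along:

* `sd_pairMul` — for an admissible skew-Hermitian direction `X`, any matrix `Y`, any word `w` from `x₀`, and any
  continuous `g : GaugeConfig → ℂ` with `g(U[e ↦ h]) = g(U)` for all `h`: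
  `∫ tr(Y·insDeriv_X hol w)·g dμ_β = β ∫ tr(Y ρ(hol w))·g·(−½ plaqIns_X) dμ_β`;
  the predicate `SDPairMul` and its polarisation (`sdPairMul_of_traceless`, `sdPairMul_of_skew`; the `SU(N)` / `U(N)`
  instances are in `StrongCouplingReadOnce.lean`);
* `loopEquationMul_of_sdPairMul` — for `w` closed at the source `x` of the edge:
  `Σ_k E[splitTerm_k(w)·g] + (β/2)·Σ_{ν≠μ,ε} E[plaqTerm_{ν,ε}(w)·g] = 0`;
* `coeff_mul_integral_trace_mul_eq` / `norm_integral_trace_mul_le` — THE ONE-STEP BOUND WITH A MULTIPLIER: if the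
  split terms of `w` reduce to `c·tr ρ(hol w)` pointwise with `‖c‖ = N − s/N` (the marked edge read exactly once,
  first and forward: `c = N − s/N`; last and backward: `c = −(N − s/N)`), and `‖g‖ ≤ M`, then
  `‖E[tr ρ(hol w)·g]‖ ≤ 2(d−1)(1+s)N²·M·|β|/(N² − s)` — every loop reading the marked link once, TIMES ANY BOUNDED
  FUNCTION OF THE OTHER LINKS, has expectation `O(β)` uniformly in the volume (`SU(N)`: `4(d−1)N²M|β|/(N²−1)`).

References: V. Kazakov, Z. Zheng, arXiv:2404.16925 §2.3 (multi-trace loop equations at finite `N`);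
S. Chatterjee, arXiv:1502.07719 §3; Yu. Makeenko, *Methods of contemporary gauge theory* (2002) Problem 12.7.
Everything is `[folklore]` given the tree's Schwinger–Dyson identity.
-/

noncomputable section

open MeasureTheory Filter Topology NormedSpace
open scoped Matrix.Norms.Frobenius Matrix
open Literature.MathematicalPhysics.QuantumFieldTheory
open Summit.QuantumFields.YangMills.Cruxes.CurvatureAmnesia.WardDefect.SchwingerDyson

namespace Summit.QuantumFields.GaugeBoot

variable {d L N : ℕ} {G : Type} [Group G] {ρ : G →* Matrix (Fin N) (Fin N) ℂ}

/-! ## The pair identity with a multiplier -/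

section SDPairMul

variable [TopologicalSpace G] [IsTopologicalGroup G] [CompactSpace G] [MeasurableSpace G] [BorelSpace G]
  (r : LatticeRep G)

/-- **The one-link Schwinger–Dyson identity for a word TIMES A MULTIPLIER THAT IGNORES THE LINK (pair form).**  For
an admissible direction `X` (skew-Hermitian, `r.ρ(k t) = exp(tX)` along a one-parameter subgroup `k`), ANY matrix `Y`,
a word `w` from `x₀`, the edge `e = (x, μ)`, and a continuous `g` with `g(U[e ↦ h]) = g(U)`:
`∫ tr(Y·insDeriv_X hol w)·g dμ_β = β ∫ tr(Y ρ(hol w))·g·(−½ plaqIns_X) dμ_β` (product rule with `∂g = 0`). [folklore] -/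
theorem sd_pairMul [NeZero L] (β : ℝ) (x : Site d L) (μ : Fin d) {k : ℝ → G} (hk : ∀ s t, k (s + t) = k s * k t)
    {X : Matrix (Fin r.N) (Fin r.N) ℂ} (hX : ∀ t, r.ρ (k t) = exp ((t : ℂ) • X)) (hXs : Xᴴ = -X)
    (Y : Matrix (Fin r.N) (Fin r.N) ℂ) (x₀ : Site d L) (w : Word d) {g : GaugeConfig d L G → ℂ} (hg : Continuous g)
    (hge : ∀ (U : GaugeConfig d L G) (h : G), g (Function.update U (x, μ) h) = g U) :
    ∫ U, (Y * insDeriv r.ρ (x, μ) X U x₀ w).trace * g U ∂(wilsonMeasure (d := d) (L := L) r.ρ β) =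
      (β : ℂ) * ∫ U, (Y * r.ρ (wordHolonomy U x₀ w)).trace * g U * (-(1 / 2) * plaqIns r.ρ X U x μ)
        ∂(wilsonMeasure (d := d) (L := L) r.ρ β) := by
  have h := integral_shiftDeriv_eq_wilson_complex r β (x, μ) hk
    (fun U => (Y * r.ρ (wordHolonomy U x₀ w)).trace * g U)
    (fun U => (Y * insDeriv r.ρ (x, μ) X U x₀ w).trace * g U)
    (((continuous_const.mul (r.continuous.comp (continuous_wordHolonomy x₀ w))).matrix_trace).mul hg)
    (((continuous_const.mul (continuous_insDeriv (e := (x, μ)) (X := X) r.continuous x₀ w)).matrix_trace).mul hg)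
    (fun U => by
      have h1 : HasDerivAt (fun t : ℝ => (Y * r.ρ (wordHolonomy (Function.update U (x, μ) (k t * U (x, μ))) x₀ w)).trace)
          ((Y * insDeriv r.ρ (x, μ) X U x₀ w).trace) 0 := by
        have hd := (traceMulLeftCLM Y).hasFDerivAt.comp_hasDerivAt (0 : ℝ)
          (hasDerivAt_wordHolonomy (e := (x, μ)) hk hX U x₀ w)
        simpa [Function.comp_def] using hd.congr_deriv (traceMulLeftCLM_apply Y _)
      have hfun : (fun t : ℝ => (Y * r.ρ (wordHolonomy (Function.update U (x, μ) (k t * U (x, μ))) x₀ w)).trace *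
            g (Function.update U (x, μ) (k t * U (x, μ)))) =
          fun t : ℝ => (Y * r.ρ (wordHolonomy (Function.update U (x, μ) (k t * U (x, μ))) x₀ w)).trace * g U :=
        funext fun t => by rw [hge]
      rw [hfun]
      exact h1.mul_const (g U))
    (actionDeriv r.ρ (x, μ) X) (continuous_actionDeriv (e := (x, μ)) (X := X) r.continuous)
    (fun U => hasDerivAt_wilsonAction (e := (x, μ)) hk hX U)
  rw [h]
  congr 1
  refine integral_congr_ae (ae_of_all _ fun U => ?_)
  simp only [actionDeriv_eq_plaqIns hXs r.mem_unitary U x μ]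

/-- THE PAIR IDENTITY WITH A MULTIPLIER for the direction `X` (word `w` from `x₀`, edge `(x, μ)`, multiplier `g`,
coupling `β`), as a predicate in `X` (used to organise polarisation — not a named fact). [folklore] -/
def SDPairMul [NeZero L] (β : ℝ) (x : Site d L) (μ : Fin d) (x₀ : Site d L) (w : Word d) (g : GaugeConfig d L G → ℂ)
    (X : Matrix (Fin r.N) (Fin r.N) ℂ) : Prop :=
  ∀ Y : Matrix (Fin r.N) (Fin r.N) ℂ,
    ∫ U, (Y * insDeriv r.ρ (x, μ) X U x₀ w).trace * g U ∂(wilsonMeasure (d := d) (L := L) r.ρ β) =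
      (β : ℂ) * ∫ U, (Y * r.ρ (wordHolonomy U x₀ w)).trace * g U * (-(1 / 2) * plaqIns r.ρ X U x μ)
        ∂(wilsonMeasure (d := d) (L := L) r.ρ β)

/-- `sd_pairMul` restated: admissible skew-Hermitian directions satisfy the pair identity with a multiplier.
[folklore] -/
theorem sdPairMul_of_oneParam [NeZero L] (β : ℝ) (x : Site d L) (μ : Fin d) (x₀ : Site d L) (w : Word d)
    {g : GaugeConfig d L G → ℂ} (hg : Continuous g) (hge : ∀ (U : GaugeConfig d L G) (h : G), g (Function.update U (x, μ) h) = g U)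
    {X : Matrix (Fin r.N) (Fin r.N) ℂ} (hXs : Xᴴ = -X) {k : ℝ → G}
    (hk : ∀ s t, k (s + t) = k s * k t) (hX : ∀ t, r.ρ (k t) = exp ((t : ℂ) • X)) :
    SDPairMul r β x μ x₀ w g X :=
  fun Y => sd_pairMul r β x μ hk hX hXs Y x₀ w hg hge

omit [CompactSpace G] [MeasurableSpace G] [BorelSpace G] in
/-- Continuity of the left integrand of the multiplier identity. [folklore] -/
theorem continuous_lhsMul (Y X : Matrix (Fin r.N) (Fin r.N) ℂ) (x : Site d L) (μ : Fin d) (x₀ : Site d L) (w : Word d)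
    {g : GaugeConfig d L G → ℂ} (hg : Continuous g) :
    Continuous fun U : GaugeConfig d L G => (Y * insDeriv r.ρ (x, μ) X U x₀ w).trace * g U :=
  ((continuous_const.mul (continuous_insDeriv (e := (x, μ)) (X := X) r.continuous x₀ w)).matrix_trace).mul hg

omit [CompactSpace G] [MeasurableSpace G] [BorelSpace G] in
/-- Continuity of the right integrand of the multiplier identity. [folklore] -/
theorem continuous_rhsMul (Y X : Matrix (Fin r.N) (Fin r.N) ℂ) (x : Site d L) (μ : Fin d) (x₀ : Site d L) (w : Word d)
    {g : GaugeConfig d L G → ℂ} (hg : Continuous g) : Continuous fun U : GaugeConfig d L G =>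
      (Y * r.ρ (wordHolonomy U x₀ w)).trace * g U * (-(1 / 2) * plaqIns r.ρ X U x μ) :=
  (((continuous_const.mul (r.continuous.comp (continuous_wordHolonomy x₀ w))).matrix_trace).mul hg).mul
    (continuous_const.mul (continuous_plaqIns r X x μ))

/-- **Polarisation step** for the multiplier identity (both sides are `ℂ`-linear in `X`). [folklore] -/
theorem sdPairMul_of_parts [NeZero L] (β : ℝ) (x : Site d L) (μ : Fin d) (x₀ : Site d L) (w : Word d)
    {g : GaugeConfig d L G → ℂ} (hg : Continuous g) (X : Matrix (Fin r.N) (Fin r.N) ℂ)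
    (hPA : SDPairMul r β x μ x₀ w g ((1 / 2 : ℂ) • (X - Xᴴ)))
    (hPB : SDPairMul r β x μ x₀ w g ((Complex.I / 2) • (X + Xᴴ))) : SDPairMul r β x μ x₀ w g X := by
  set A : Matrix (Fin r.N) (Fin r.N) ℂ := (1 / 2 : ℂ) • (X - Xᴴ) with hA
  set B : Matrix (Fin r.N) (Fin r.N) ℂ := (Complex.I / 2) • (X + Xᴴ) with hB
  have hXAB : X = A + (-Complex.I) • B := eq_skewPart_add X
  clear_value A B
  intro Y
  have hiA := integrable_of_continuous r β (continuous_lhsMul r Y A x μ x₀ w hg)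
  have hiB := integrable_of_continuous r β (continuous_lhsMul r Y B x μ x₀ w hg)
  have hjA := integrable_of_continuous r β (continuous_rhsMul r Y A x μ x₀ w hg)
  have hjB := integrable_of_continuous r β (continuous_rhsMul r Y B x μ x₀ w hg)
  have hl : ∀ U : GaugeConfig d L G, (Y * insDeriv r.ρ (x, μ) X U x₀ w).trace * g U =
      (Y * insDeriv r.ρ (x, μ) A U x₀ w).trace * g U +
        (-Complex.I) * ((Y * insDeriv r.ρ (x, μ) B U x₀ w).trace * g U) := by
    intro U
    rw [hXAB, insDeriv_add, insDeriv_smul, Matrix.mul_add, Matrix.mul_smul, Matrix.trace_add, Matrix.trace_smul,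
      smul_eq_mul]
    ring
  have hr : ∀ U : GaugeConfig d L G,
      (Y * r.ρ (wordHolonomy U x₀ w)).trace * g U * (-(1 / 2) * plaqIns r.ρ X U x μ) =
        (Y * r.ρ (wordHolonomy U x₀ w)).trace * g U * (-(1 / 2) * plaqIns r.ρ A U x μ) +
          (-Complex.I) * ((Y * r.ρ (wordHolonomy U x₀ w)).trace * g U * (-(1 / 2) * plaqIns r.ρ B U x μ)) := by
    intro U
    rw [hXAB, plaqIns_add, plaqIns_smul]
    ring
  simp_rw [hl, hr]
  rw [integral_add hiA (hiB.const_mul _), integral_const_mul, integral_add hjA (hjB.const_mul _),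
    integral_const_mul, hPA Y, hPB Y]
  ring

/-- **Polarisation (`𝔰𝔲`-type)** for the multiplier identity. [folklore] -/
theorem sdPairMul_of_traceless [NeZero L] (β : ℝ) (x : Site d L) (μ : Fin d) (x₀ : Site d L) (w : Word d)
    {g : GaugeConfig d L G → ℂ} (hg : Continuous g)
    (hadm : ∀ X : Matrix (Fin r.N) (Fin r.N) ℂ, Xᴴ = -X → X.trace = 0 → SDPairMul r β x μ x₀ w g X)
    (X : Matrix (Fin r.N) (Fin r.N) ℂ) (hX : X.trace = 0) : SDPairMul r β x μ x₀ w g X :=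
  sdPairMul_of_parts r β x μ x₀ w hg X (hadm _ (conjTranspose_skewPart X) (trace_parts_eq_zero hX _).1)
    (hadm _ (conjTranspose_iHermPart X) (trace_parts_eq_zero hX _).2)

/-- **Polarisation (`𝔲`-type)** for the multiplier identity. [folklore] -/
theorem sdPairMul_of_skew [NeZero L] (β : ℝ) (x : Site d L) (μ : Fin d) (x₀ : Site d L) (w : Word d)
    {g : GaugeConfig d L G → ℂ} (hg : Continuous g)
    (hadm : ∀ X : Matrix (Fin r.N) (Fin r.N) ℂ, Xᴴ = -X → SDPairMul r β x μ x₀ w g X)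
    (X : Matrix (Fin r.N) (Fin r.N) ℂ) : SDPairMul r β x μ x₀ w g X :=
  sdPairMul_of_parts r β x μ x₀ w hg X (hadm _ (conjTranspose_skewPart X)) (hadm _ (conjTranspose_iHermPart X))

end SDPairMul

/-! ## The loop equation with a multiplier -/

section LoopEquationMul

variable [TopologicalSpace G] [IsTopologicalGroup G] [CompactSpace G] [MeasurableSpace G] [BorelSpace G]
  (r : LatticeRep G)

/-- **THE SINGLE-LINK LOOP EQUATION WITH AN EDGE-INDEPENDENT MULTIPLIER (abstract form).**  Let `G` be compact with
lattice representation `r`, `β` real, `e = (x, μ)` an edge of `(ℤ/L)^d`, `w` a word CLOSED at `x`, `g` a continuous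
function of the configuration, and `s ∈ ℂ` a weight such that every direction `X_ij = E_ij − (s/N)δ_ij·1` satisfies
the multiplier identity `SDPairMul` (which holds, for `g` ignoring the link `e`, when `s = 1`, `G = SU(N)`, or
`s = 0`, `G = U(N)`).  Then
`Σ_k E[splitTerm_k(w)·g] + (β/2)·Σ_{ν≠μ} Σ_ε E[plaqTerm_{ν,ε}(w)·g] = 0`. [folklore] -/
theorem loopEquationMul_of_sdPairMul [NeZero L] (β : ℝ) (x : Site d L) (μ : Fin d) (s : ℂ) (w : Word d)
    (hw : Word.endpoint x w = x) {g : GaugeConfig d L G → ℂ} (hg : Continuous g)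
    (hP : ∀ i j : Fin r.N, SDPairMul r β x μ x w g (unitDir s i j)) :
    (∑ k ∈ Finset.range w.length, ∫ U, splitTerm r.ρ s x μ U w k * g U ∂(wilsonMeasure (d := d) (L := L) r.ρ β)) +
      (β / 2 : ℂ) * ∑ ν ∈ Finset.univ.erase μ, ∑ ε : Bool,
        ∫ U, plaqTerm r.ρ s x μ U w ν ε * g U ∂(wilsonMeasure (d := d) (L := L) r.ρ β) = 0 := by
  set μW := wilsonMeasure (d := d) (L := L) r.ρ β with hμW
  have hf : ∀ i j : Fin r.N, Integrable
      (fun U => (Matrix.single j i (1 : ℂ) * insDeriv r.ρ (x, μ) (unitDir s i j) U x w).trace * g U) μW :=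
    fun i j => integrable_of_continuous r β (continuous_lhsMul r _ _ x μ x w hg)
  have hg' : ∀ i j : Fin r.N, Integrable (fun U => (Matrix.single j i (1 : ℂ) * r.ρ (wordHolonomy U x w)).trace * g U *
      (-(1 / 2) * plaqIns r.ρ (unitDir s i j) U x μ)) μW :=
    fun i j => integrable_of_continuous r β (continuous_rhsMul r _ _ x μ x w hg)
  -- pointwise: the contracted left side is `(Σ_k splitTerm_k) · g`
  have hL : ∀ U : GaugeConfig d L G, ∑ i : Fin r.N, ∑ j : Fin r.N,
      (Matrix.single j i (1 : ℂ) * insDeriv r.ρ (x, μ) (unitDir s i j) U x w).trace * g U =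
      (∑ k ∈ Finset.range w.length, splitTerm r.ρ s x μ U w k) * g U := by
    intro U
    rw [← sum_trace_insDeriv_unitDir s x μ U w, Finset.sum_mul]
    exact Finset.sum_congr rfl fun i _ => by rw [Finset.sum_mul]
  -- pointwise: the contracted right side
  have hR : ∀ U : GaugeConfig d L G, ∑ i : Fin r.N, ∑ j : Fin r.N,
      (Matrix.single j i (1 : ℂ) * r.ρ (wordHolonomy U x w)).trace * g U *
        (-(1 / 2) * plaqIns r.ρ (unitDir s i j) U x μ) =
      (-(1 / 2) * ∑ ν ∈ Finset.univ.erase μ, ∑ ε : Bool, plaqTerm r.ρ s x μ U w ν ε) * g U := by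
    intro U
    rw [← sum_trace_mul_plaqIns_unitDir s x μ U w hw, Finset.sum_mul]
    refine Finset.sum_congr rfl fun i _ => ?_
    rw [Finset.sum_mul]
    exact Finset.sum_congr rfl fun j _ => by ring
  -- integrate the contracted identity
  have hsum : ∫ U, (∑ k ∈ Finset.range w.length, splitTerm r.ρ s x μ U w k) * g U ∂μW =
      (β : ℂ) * ∫ U, (-(1 / 2) * ∑ ν ∈ Finset.univ.erase μ, ∑ ε : Bool, plaqTerm r.ρ s x μ U w ν ε) * g U ∂μW := by
    calc ∫ U, (∑ k ∈ Finset.range w.length, splitTerm r.ρ s x μ U w k) * g U ∂μW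
        = ∫ U, ∑ i : Fin r.N, ∑ j : Fin r.N,
            (Matrix.single j i (1 : ℂ) * insDeriv r.ρ (x, μ) (unitDir s i j) U x w).trace * g U ∂μW :=
          integral_congr_ae (ae_of_all _ fun U => (hL U).symm)
      _ = ∑ i : Fin r.N, ∑ j : Fin r.N, ∫ U,
            (Matrix.single j i (1 : ℂ) * insDeriv r.ρ (x, μ) (unitDir s i j) U x w).trace * g U ∂μW := by
          rw [integral_finsetSum _ fun i _ => integrable_finsetSum _ fun j _ => hf i j]
          exact Finset.sum_congr rfl fun i _ => integral_finsetSum _ fun j _ => hf i j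
      _ = ∑ i : Fin r.N, ∑ j : Fin r.N, (β : ℂ) * ∫ U, (Matrix.single j i (1 : ℂ) * r.ρ (wordHolonomy U x w)).trace *
            g U * (-(1 / 2) * plaqIns r.ρ (unitDir s i j) U x μ) ∂μW :=
          Finset.sum_congr rfl fun i _ => Finset.sum_congr rfl fun j _ => hP i j (Matrix.single j i 1)
      _ = (β : ℂ) * ∑ i : Fin r.N, ∑ j : Fin r.N, ∫ U, (Matrix.single j i (1 : ℂ) * r.ρ (wordHolonomy U x w)).trace *
            g U * (-(1 / 2) * plaqIns r.ρ (unitDir s i j) U x μ) ∂μW := by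
          simp only [Finset.mul_sum]
      _ = (β : ℂ) * ∫ U, ∑ i : Fin r.N, ∑ j : Fin r.N, (Matrix.single j i (1 : ℂ) * r.ρ (wordHolonomy U x w)).trace *
            g U * (-(1 / 2) * plaqIns r.ρ (unitDir s i j) U x μ) ∂μW := by
          rw [integral_finsetSum _ fun i _ => integrable_finsetSum _ fun j _ => hg' i j]
          congr 1
          exact (Finset.sum_congr rfl fun i _ => integral_finsetSum _ fun j _ => hg' i j).symm
      _ = (β : ℂ) * ∫ U, (-(1 / 2) * ∑ ν ∈ Finset.univ.erase μ, ∑ ε : Bool, plaqTerm r.ρ s x μ U w ν ε) * g U ∂μW := by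
          congr 1
          exact integral_congr_ae (ae_of_all _ fun U => hR U)
  -- split the integrals into the stated sums
  have hi1 : ∀ k, Integrable (fun U => splitTerm r.ρ s x μ U w k * g U) μW :=
    fun k => integrable_of_continuous r β ((continuous_splitTerm r s x μ w k).mul hg)
  have hi3 : ∀ ν ε, Integrable (fun U => plaqTerm r.ρ s x μ U w ν ε * g U) μW :=
    fun ν ε => integrable_of_continuous r β ((continuous_plaqTerm r s x μ w ν ε).mul hg)
  have h1 : ∫ U, (∑ k ∈ Finset.range w.length, splitTerm r.ρ s x μ U w k) * g U ∂μW =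
      ∑ k ∈ Finset.range w.length, ∫ U, splitTerm r.ρ s x μ U w k * g U ∂μW := by
    simp_rw [Finset.sum_mul]
    rw [integral_finsetSum _ fun k _ => hi1 k]
  have h2 : ∫ U, (-(1 / 2) * ∑ ν ∈ Finset.univ.erase μ, ∑ ε : Bool, plaqTerm r.ρ s x μ U w ν ε) * g U ∂μW =
      -(1 / 2) * ∑ ν ∈ Finset.univ.erase μ, ∑ ε : Bool, ∫ U, plaqTerm r.ρ s x μ U w ν ε * g U ∂μW := by
    have : ∀ U : GaugeConfig d L G, (-(1 / 2) * ∑ ν ∈ Finset.univ.erase μ, ∑ ε : Bool, plaqTerm r.ρ s x μ U w ν ε) * g U =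
        -(1 / 2) * ∑ ν ∈ Finset.univ.erase μ, ∑ ε : Bool, plaqTerm r.ρ s x μ U w ν ε * g U := fun U => by
      rw [mul_assoc, Finset.sum_mul]
      congr 1
      exact Finset.sum_congr rfl fun ν _ => Finset.sum_mul _ _ _
    simp_rw [this]
    rw [integral_const_mul]
    congr 1
    rw [integral_finsetSum _ fun ν _ => integrable_finsetSum _ fun ε _ => hi3 ν ε]
    exact Finset.sum_congr rfl fun ν _ => integral_finsetSum _ fun ε _ => hi3 ν ε
  rw [h1, h2] at hsum
  linear_combination hsum

/-- **THE ONE-STEP IDENTITY WITH A MULTIPLIER.**  If the split terms of the closed word `w` at `(x, μ)` reduce to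
`c·tr ρ(hol w)` pointwise (the edge read exactly once: first and forward, `c = N − s/N`; last and backward,
`c = −(N − s/N)`), then `c·E[tr ρ(hol w)·g] = −(β/2)·Σ_{ν≠μ,ε} E[plaqTerm_{ν,ε}(w)·g]`. [folklore] -/
theorem coeff_mul_integral_trace_mul_eq [NeZero L] (β : ℝ) (x : Site d L) (μ : Fin d) (s c : ℂ) (w : Word d)
    (hw : Word.endpoint x w = x)
    (hsplit : ∀ U : GaugeConfig d L G, ∑ k ∈ Finset.range w.length, splitTerm r.ρ s x μ U w k =
      c * (r.ρ (wordHolonomy U x w)).trace)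
    {g : GaugeConfig d L G → ℂ} (hg : Continuous g) (hP : ∀ i j : Fin r.N, SDPairMul r β x μ x w g (unitDir s i j)) :
    c * ∫ U, (r.ρ (wordHolonomy U x w)).trace * g U ∂(wilsonMeasure (d := d) (L := L) r.ρ β) =
      -((β / 2 : ℂ) * ∑ ν ∈ Finset.univ.erase μ, ∑ ε : Bool,
        ∫ U, plaqTerm r.ρ s x μ U w ν ε * g U ∂(wilsonMeasure (d := d) (L := L) r.ρ β)) := by
  have h := loopEquationMul_of_sdPairMul r β x μ s w hw hg hP
  rw [← integral_finsetSum _ fun k _ => integrable_of_continuous r β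
    (F := fun U => splitTerm r.ρ s x μ U w k * g U) ((continuous_splitTerm r s x μ w k).mul hg)] at h
  simp_rw [← Finset.sum_mul, hsplit] at h
  have e1 : ∀ U : GaugeConfig d L G, c * (r.ρ (wordHolonomy U x w)).trace * g U =
      c * ((r.ρ (wordHolonomy U x w)).trace * g U) := fun U => by ring
  simp_rw [e1] at h
  rw [integral_const_mul] at h
  linear_combination h

omit [IsTopologicalGroup G] [CompactSpace G] [MeasurableSpace G] [BorelSpace G] in
/-- **Pointwise bound** `‖plaqTerm · g‖ ≤ 2N(1+‖s‖)·M` for `‖g‖ ≤ M`. [folklore] -/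
theorem norm_plaqTerm_mul_le (s : ℂ) (x : Site d L) (μ : Fin d) (U : GaugeConfig d L G) (w : Word d) (ν : Fin d)
    (ε : Bool) {g : GaugeConfig d L G → ℂ} {M : ℝ} (hM : ∀ U, ‖g U‖ ≤ M) :
    ‖plaqTerm r.ρ s x μ U w ν ε * g U‖ ≤ 2 * r.N * (1 + ‖s‖) * M := by
  rw [norm_mul]
  exact mul_le_mul (StrongCoupling.norm_plaqTerm_le r s x μ U w ν ε) (hM U) (norm_nonneg _) (by positivity)

/-- **The right sides with a multiplier are bounded**: `‖ΣΣ E[plaqTerm·g]‖ ≤ (d−1)·2·(2N(1+‖s‖)·M)`. [folklore] -/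
theorem norm_sum_sum_integral_plaqTerm_mul_le [NeZero L] (β : ℝ) (s : ℂ) (x : Site d L) (μ : Fin d) (w : Word d)
    {g : GaugeConfig d L G → ℂ} {M : ℝ} (hM : ∀ U, ‖g U‖ ≤ M) :
    ‖∑ ν ∈ Finset.univ.erase μ, ∑ ε : Bool, ∫ U, plaqTerm r.ρ s x μ U w ν ε * g U
        ∂(wilsonMeasure (d := d) (L := L) r.ρ β)‖ ≤ ((d : ℝ) - 1) * (2 * (2 * r.N * (1 + ‖s‖) * M)) := by
  haveI := isProbabilityMeasure_wilsonMeasure (d := d) (L := L) r.ρ r.continuous β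
  have hterm : ∀ ν ε, ‖∫ U, plaqTerm r.ρ s x μ U w ν ε * g U ∂(wilsonMeasure (d := d) (L := L) r.ρ β)‖ ≤
      2 * r.N * (1 + ‖s‖) * M := fun ν ε => by
    have h := norm_integral_le_of_norm_le_const (μ := wilsonMeasure (d := d) (L := L) r.ρ β)
      (ae_of_all _ fun U => norm_plaqTerm_mul_le r s x μ U w ν ε hM)
    rwa [probReal_univ, mul_one] at h
  calc _ ≤ ∑ ν ∈ Finset.univ.erase μ, ‖∑ ε : Bool, ∫ U, plaqTerm r.ρ s x μ U w ν ε * g U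
          ∂(wilsonMeasure (d := d) (L := L) r.ρ β)‖ := norm_sum_le _ _
    _ ≤ ∑ ν ∈ Finset.univ.erase μ, (2 * (2 * r.N * (1 + ‖s‖) * M)) := by
        refine Finset.sum_le_sum fun ν _ => (norm_sum_le _ _).trans ?_
        calc _ ≤ ∑ _ε : Bool, 2 * r.N * (1 + ‖s‖) * M := Finset.sum_le_sum fun ε _ => hterm ν ε
          _ = 2 * (2 * r.N * (1 + ‖s‖) * M) := by simp [two_mul]
    _ = ((d : ℝ) - 1) * (2 * (2 * r.N * (1 + ‖s‖) * M)) := by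
        rw [Finset.sum_const, nsmul_eq_mul, StrongCoupling.card_univ_erase_real]

/-- **THE ONE-STEP BOUND WITH A MULTIPLIER.**  Under the hypothesis of `coeff_mul_integral_trace_mul_eq` with a real
weight `0 ≤ s < N²`, a coefficient of modulus `‖c‖ = N − s/N` and a multiplier bounded by `M`:
`‖E[tr ρ(hol w)·g]‖ ≤ 2(d−1)(1+s)N²·M·|β|/(N² − s)` — a loop reading the marked link exactly once, times any bounded
continuous function of the OTHER links, has expectation `O(β)` uniformly in the volume. [folklore] -/
theorem norm_integral_trace_mul_le [NeZero L] (β : ℝ) (x : Site d L) (μ : Fin d) {s : ℝ} (hs0 : 0 ≤ s)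
    (hsN : s < (r.N : ℝ) ^ 2) {c : ℂ} (hc : ‖c‖ = (r.N : ℝ) - s / r.N) (w : Word d) (hw : Word.endpoint x w = x)
    (hsplit : ∀ U : GaugeConfig d L G, ∑ k ∈ Finset.range w.length, splitTerm r.ρ (s : ℂ) x μ U w k =
      c * (r.ρ (wordHolonomy U x w)).trace)
    {g : GaugeConfig d L G → ℂ} (hg : Continuous g) {M : ℝ} (hM : ∀ U, ‖g U‖ ≤ M)
    (hP : ∀ i j : Fin r.N, SDPairMul r β x μ x w g (unitDir (s : ℂ) i j)) :
    ‖∫ U, (r.ρ (wordHolonomy U x w)).trace * g U ∂(wilsonMeasure (d := d) (L := L) r.ρ β)‖ ≤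
      2 * ((d : ℝ) - 1) * (1 + s) * (r.N : ℝ) ^ 2 * M * |β| / ((r.N : ℝ) ^ 2 - s) := by
  have hN0 : r.N ≠ 0 := by
    rintro h; rw [h] at hsN; simp at hsN; linarith
  have hNpos : (0 : ℝ) < r.N := by exact_mod_cast Nat.pos_of_ne_zero hN0
  have hM0 : 0 ≤ M := (norm_nonneg _).trans (hM (fun _ => 1))
  set c₀ : ℝ := (r.N : ℝ) - s / r.N with hc₀
  have hcpos : 0 < c₀ := by
    rw [hc₀, sub_pos, div_lt_iff₀ hNpos, ← sq]; exact hsN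
  have h := coeff_mul_integral_trace_mul_eq r β x μ (s : ℂ) c w hw hsplit hg hP
  have hn := congrArg (fun z : ℂ => ‖z‖) h
  simp only [norm_mul, norm_neg, hc] at hn
  have hS := norm_sum_sum_integral_plaqTerm_mul_le r β (s : ℂ) x μ w hM
  rw [Complex.norm_real, Real.norm_eq_abs, abs_of_nonneg hs0] at hS
  have hβ2 : ‖(β / 2 : ℂ)‖ = |β| / 2 := by
    rw [show (β / 2 : ℂ) = ((β / 2 : ℝ) : ℂ) by push_cast; ring, Complex.norm_real, Real.norm_eq_abs, abs_div,
      abs_two]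
  rw [hβ2] at hn
  have hd1 : (0 : ℝ) ≤ (d : ℝ) - 1 := by
    have : (1 : ℝ) ≤ d := by exact_mod_cast (Fin.pos μ)
    linarith
  have hmain : c₀ * ‖∫ U, (r.ρ (wordHolonomy U x w)).trace * g U ∂(wilsonMeasure (d := d) (L := L) r.ρ β)‖ ≤
      |β| / 2 * (((d : ℝ) - 1) * (2 * (2 * r.N * (1 + s) * M))) := by
    rw [hc₀, hn]; exact mul_le_mul_of_nonneg_left hS (by positivity)
  rw [le_div_iff₀ (by nlinarith [hcpos, hNpos] : (0 : ℝ) < (r.N : ℝ) ^ 2 - s)]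
  have hcN : c₀ * r.N = (r.N : ℝ) ^ 2 - s := by rw [hc₀]; field_simp
  calc ‖∫ U, (r.ρ (wordHolonomy U x w)).trace * g U ∂(wilsonMeasure (d := d) (L := L) r.ρ β)‖ * ((r.N : ℝ) ^ 2 - s)
      = (c₀ * ‖∫ U, (r.ρ (wordHolonomy U x w)).trace * g U ∂(wilsonMeasure (d := d) (L := L) r.ρ β)‖) * r.N := by
        rw [← hcN]; ring
    _ ≤ (|β| / 2 * (((d : ℝ) - 1) * (2 * (2 * r.N * (1 + s) * M)))) * r.N :=
        mul_le_mul_of_nonneg_right hmain hNpos.le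
    _ = 2 * ((d : ℝ) - 1) * (1 + s) * (r.N : ℝ) ^ 2 * M * |β| := by ring

end LoopEquationMul


end Summit.QuantumFields.GaugeBoot

end
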